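import Mathlib
import Summits.ResolutionOfSingularities.ResolutionOfSingularities.Theorems.RadicialJungCleanModelsCleanLU3CompositeLiftIter
import Summits.ResolutionOfSingularities.ResolutionOfSingularities.Theorems.RadicialJungCleanModelsCleanLU3CompositeLift
import Summits.ResolutionOfSingularities.ResolutionOfSingularities.Theorems.RadicialJungCleanModelsCleanLU3Defectless
import HarnessLib

/-!
# Route `RadicialJung`, crux `CleanModels` (stmt-15917), stub `stub_cleanLU3DefectNonDiscrete`, sub-line (C-div): the LIFT LEMMA

Line `Sketch` rev 24 of crux stmt-ResolutionOfSingularities-15917; lead `res-B-lead-1` g4 (workfile `Lines/Sketch_Cdiv_assembly.lean` v2,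
piece LIFT LEMMA; memo `Lines/Sketch-memo-Cdiv-lift.md` §2, critic TRIAGE-72 §2).  OURS; nothing here proves resolution in characteristic `p`.

`lift_clean`: let `R = locAtCentre Aₘ O` be the regular local ring of a finitely generated model along `O` (dimension `3`, every centre above
the base model `A` closed), `O ≤ O₁` a coarsening with `O₁ ⊆ locAtCentre R O₁` and non-zero centre on `R`, `S = im R ⊆ κ(O₁)` its residue image
(a local ring dominated by `Ō`) with a regular system of parameters `(x̄, ȳ)`, and `u ∈ R`.  Suppose DOWNSTAIRS a non-trivial representative
`Σ c̄_j^p ū^j` of the `κ₁^p`-line of `ū = res u` is loosely clean at `S` — form (1) `ε̄ x̄^a ȳ^b` read in `(x̄, ȳ)`, or form (2), or form (3) —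
and that its coefficients have denominators a product of regular parameters: `c̄_j · ∏ f̄ᵢ^{eᵢ} ∈ S` for a list of pairs `(f̄ᵢ, ḡᵢ)` each
generating `𝔪_S`.  THEN on some finitely generated model `A' ⊇ A` along `O` with regular local ring, some non-trivial representative
`Σ c_j^p u^j` of the `K^p`-line of `u` is loosely clean (the conclusion of the stub, for `u`).  Proof: lift numerators and denominators to `R`,
`G := Σ a_j^p u^j ∈ R` has residue `D̄^p · (clean form)`; lift the form modulo the prime `π` of the coarse centre (`G = D^p · lift + π W`);
blow up the curves `(π, fᵢ)` (✓ `exists_model_div_list`) so that `τ := π / D^p` is a regular parameter of a bigger model with the same residue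
image; there `Σ (a_j/D)^p u^j = lift + τ W`, and ✓ `formOne_lift` / ✓ `formTwo_lift` / ✓ `formThree_lift` conclude.
-/

noncomputable section

set_option linter.dupNamespace false -- mandated namespace of this single-conjunct summit

open IsLocalRing
open Literature.AlgebraicGeometry.Resolution

namespace Summit.ResolutionOfSingularities.ResolutionOfSingularities.Theorems.RadicialJung.CleanModels

variable {K : Type} [Field K] {k : Type} [Field k] [Algebra k K]

/-- Powers in a list product: `∏ (aᵢ ^ (p eᵢ)) = (∏ aᵢ ^ eᵢ)^p`. [folklore] -/
theorem list_prod_pow_mul {M : Type*} [CommMonoid M] {ι : Type*} (L : List ι) (a : ι → M) (e : ι → ℕ) (p : ℕ) :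
    (L.map fun i => a i ^ (p * e i)).prod = ((L.map fun i => a i ^ e i).prod) ^ p := by
  induction L with
  | nil => simp
  | cons i L ih => rw [List.map_cons, List.map_cons, List.prod_cons, List.prod_cons, ih, mul_pow, pow_mul']

/-- **THE LIFT LEMMA.**  See the module docstring. [folklore] -/
theorem lift_clean (p : ℕ) [hp : Fact p.Prime] [CharP K p]
    (O O₁ : ValuationSubring K) (hOO₁ : O ≤ O₁) (A : Subalgebra k K) (hAfg : A.FG) [IsFractionRing A K]
    (hzd : ∀ (T : Subring K) (hT : T ≤ O.toSubring), A.toSubring ≤ T → (subringCentre T O hT).IsMaximal)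
    (hdimA : ringKrullDim A = 3)
    (Aₘ : Subalgebra k K) (hAAₘ : A ≤ Aₘ) (hAₘfg : Aₘ.FG) (hAₘO : Aₘ.toSubring ≤ O.toSubring)
    (hregm : IsRegularLocalRing (locAtCentre Aₘ.toSubring O))
    (hloc : O₁.toSubring ≤ locAtCentre (locAtCentre Aₘ.toSubring O) O₁)
    (hcentre : ∃ r ∈ locAtCentre Aₘ.toSubring O, r ≠ 0 ∧ O₁.valuation r < 1)
    (u : K) (hu : u ∈ locAtCentre Aₘ.toSubring O)
    (S : Subring (ResidueField O₁)) [IsLocalRing S] (hSdom : SubringDominates S (residueValuationSubring O O₁ hOO₁).toSubring)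
    (himm : ((locAtCentre Aₘ.toSubring O).comap O₁.toSubring.subtype).map (residue O₁) = S)
    (cb : Fin p → ResidueField O₁) (hcb : ∃ j : Fin p, (j : ℕ) ≠ 0 ∧ cb j ≠ 0)
    (xb yb : S) (hxb0 : (xb : ResidueField O₁) ≠ 0) (hyb0 : (yb : ResidueField O₁) ≠ 0)
    (hxy : maximalIdeal S = Ideal.span {xb, yb})
    (Lb : List (ResidueField O₁ × ResidueField O₁ × ℕ))
    (hLb : ∀ t ∈ Lb, t.1 ≠ 0 ∧ ∃ (h₁ : t.1 ∈ S) (h₂ : t.2.1 ∈ S), maximalIdeal S = Ideal.span {⟨_, h₁⟩, ⟨_, h₂⟩})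
    (hden : ∀ j : Fin p, cb j * (Lb.map fun t => t.1 ^ t.2.2).prod ∈ S)
    (hclean :
      (∃ (a b : ℕ) (ε : S), IsUnit ε ∧ (a ≠ 0 ∨ b ≠ 0) ∧ (a = 0 ∨ ¬ p ∣ a) ∧ (b = 0 ∨ ¬ p ∣ b) ∧
        (∑ j : Fin p, cb j ^ p * residue O₁ ⟨u, hOO₁ (locAtCentre_le hAₘO hu)⟩ ^ (j : ℕ)) =
          (ε : ResidueField O₁) * (xb : ResidueField O₁) ^ a * (yb : ResidueField O₁) ^ b) ∨
      (∃ w : S, IsUnit w ∧ (∑ j : Fin p, cb j ^ p * residue O₁ ⟨u, hOO₁ (locAtCentre_le hAₘO hu)⟩ ^ (j : ℕ)) = (w : ResidueField O₁) ∧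
        ∀ c' : S, w - c' ^ p ∉ maximalIdeal S) ∨
      (∃ s c' : S, (∑ j : Fin p, cb j ^ p * residue O₁ ⟨u, hOO₁ (locAtCentre_le hAₘO hu)⟩ ^ (j : ℕ)) = (s : ResidueField O₁) ∧
        s - c' ^ p ∈ maximalIdeal S ∧ s - c' ^ p ∉ maximalIdeal S ^ 2)) :
    ∃ (A' : Subalgebra k K), A'.toSubring ≤ O.toSubring ∧ A ≤ A' ∧ A'.FG ∧
    ∃ (_ : IsRegularLocalRing (locAtCentre A'.toSubring O)) (c : Fin p → K), (∃ j : Fin p, (j : ℕ) ≠ 0 ∧ c j ≠ 0) ∧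
    ((∃ (d m : ℕ) (hmd : m ≤ d) (t : Fin d → ↥(locAtCentre A'.toSubring O)) (a : Fin m → ℕ) (w : ↥(locAtCentre A'.toSubring O)), IsUnit w ∧
    Ideal.span (Set.range t) = IsLocalRing.maximalIdeal ↥(locAtCentre A'.toSubring O) ∧
    ringKrullDim ↥(locAtCentre A'.toSubring O) = (d : WithBot ℕ∞) ∧ 0 < m ∧ (∀ i, ¬ p ∣ a i) ∧
    (∑ j : Fin p, c j ^ p * u ^ (j : ℕ)) = (w : K) * ∏ i : Fin m, ((t (Fin.castLE hmd i) : ↥(locAtCentre A'.toSubring O)) : K) ^ (a i)) ∨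
    (∃ w : ↥(locAtCentre A'.toSubring O), IsUnit w ∧ (∑ j : Fin p, c j ^ p * u ^ (j : ℕ)) = (w : K) ∧
    ∀ c' : ↥(locAtCentre A'.toSubring O), w - c' ^ p ∉ IsLocalRing.maximalIdeal ↥(locAtCentre A'.toSubring O)) ∨
    (∃ s c' : ↥(locAtCentre A'.toSubring O), (∑ j : Fin p, c j ^ p * u ^ (j : ℕ)) = (s : K) ∧
    s - c' ^ p ∈ IsLocalRing.maximalIdeal ↥(locAtCentre A'.toSubring O) ∧
    s - c' ^ p ∉ IsLocalRing.maximalIdeal ↥(locAtCentre A'.toSubring O) ^ 2)) := by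
  classical
  have hp0 : p ≠ 0 := hp.out.ne_zero
  set Ō := residueValuationSubring O O₁ hOO₁ with hŌ
  set R : Subring K := locAtCentre Aₘ.toSubring O with hR
  haveI := hregm
  have hRO : R ≤ O.toSubring := locAtCentre_le hAₘO
  have hRO₁ : R ≤ O₁.toSubring := fun z hz => hOO₁ (hRO hz)
  have hRm : ∀ r : R, r ∈ maximalIdeal R ↔ O.valuation (r : K) < 1 := fun r => mem_maximalIdeal_locAtCentre_iff hAₘO r
  have hdimR : ringKrullDim R = 3 := by
    rw [hR, ringKrullDim_locAtCentre_eq_of_isMaximal Aₘ hAₘfg O hAₘO (hzd _ hAₘO (fun z hz => hAAₘ hz)),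
      ringKrullDim_eq_of_fg_of_le hAfg hAₘfg hAAₘ, hdimA]
  have hSm : ∀ s : S, s ∈ maximalIdeal S ↔ Ō.valuation (s : ResidueField O₁) < 1 :=
    (subringDominates_valuationSubring_iff hSdom.1).mp hSdom
  -- residues and lifts
  have hresmem : ∀ (z : K) (hz : z ∈ R), residue O₁ ⟨z, hRO₁ hz⟩ ∈ S := fun z hz => himm ▸ residue_mem_residueImage O₁ R hRO₁ hz
  have hressurj : ∀ s ∈ S, ∃ (z : K) (hz : z ∈ R), residue O₁ ⟨z, hRO₁ hz⟩ = s := fun s hs =>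
    (mem_residueImage_iff O₁ R hRO₁ s).mp (himm ▸ hs : s ∈ (R.comap O₁.toSubring.subtype).map (residue O₁))
  -- a lifting function
  let lift : ResidueField O₁ → K := fun s => if hs : s ∈ S then Classical.choose (hressurj s hs) else 0
  have hliftR : ∀ {s} (hs : s ∈ S), lift s ∈ R := by
    intro s hs; simp only [lift, dif_pos hs]; exact (Classical.choose_spec (hressurj s hs)).1
  have hliftres : ∀ {s} (hs : s ∈ S), residue O₁ ⟨lift s, hRO₁ (hliftR hs)⟩ = s := by
    intro s hs
    have e : lift s = Classical.choose (hressurj s hs) := by simp only [lift, dif_pos hs]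
    obtain ⟨hz, hres⟩ := Classical.choose_spec (hressurj s hs)
    have : (⟨lift s, hRO₁ (hliftR hs)⟩ : O₁) = ⟨Classical.choose (hressurj s hs), hRO₁ hz⟩ := Subtype.ext e
    rw [this]; exact hres
  -- units: a lift of a nonzero element of `S` is an `O₁`-unit; a lift of a unit of `S` is a unit of `R`
  have hunit₁ : ∀ {z : K} (hz : z ∈ R), residue O₁ ⟨z, hRO₁ hz⟩ ≠ 0 → O₁.valuation z = 1 := by
    intro z hz hne
    apply le_antisymm ((O₁.valuation_le_one_iff _).mpr (hRO₁ hz))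
    by_contra hlt
    rw [not_le] at hlt
    exact hne (by rw [residue_eq_zero_iff]; exact (O₁.valuation_lt_one_iff _).mpr hlt)
  have hunitR : ∀ {z : K} (hz : z ∈ R), IsUnit (⟨residue O₁ ⟨z, hRO₁ hz⟩, hresmem z hz⟩ : S) → IsUnit (⟨z, hz⟩ : R) := by
    intro z hz hu'
    by_contra hnu
    have hm : (⟨z, hz⟩ : R) ∈ maximalIdeal R := hnu
    rw [hRm] at hm
    have : (⟨residue O₁ ⟨z, hRO₁ hz⟩, hresmem z hz⟩ : S) ∈ maximalIdeal S := by
      rw [hSm]; exact (residue_valuation_lt_one_iff O O₁ hOO₁ (hRO hz)).mpr hm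
    exact (IsLocalRing.mem_maximalIdeal _).mp this hu'
  -- the prime of the coarse centre
  have hcentre' : ∃ r : R, r ≠ 0 ∧ O₁.valuation (r : K) < 1 := by
    obtain ⟨r, hr, hr0, hvr⟩ := hcentre
    exact ⟨⟨r, hr⟩, fun h => hr0 (congrArg Subtype.val h), hvr⟩
  obtain ⟨π, hπ, hvπ⟩ := exists_prime_centre O₁ R hRO₁ hcentre'
  have hker : ∀ r : R, residue O₁ ⟨(r : K), hRO₁ r.2⟩ = 0 ↔ π ∣ r :=
    residue_eq_zero_iff_dvd O₁ R hRO₁ hloc π hπ hvπ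
  -- numerators and the denominator, upstairs
  set Db : ResidueField O₁ := (Lb.map fun t => t.1 ^ t.2.2).prod with hDb
  let L : List (K × K × ℕ) := Lb.map fun t => (lift t.1, lift t.2.1, p * t.2.2)
  set D : K := (Lb.map fun t => lift t.1 ^ t.2.2).prod with hD
  have hLprod : (L.map fun t => t.1 ^ t.2.2).prod = D ^ p := by
    have : (L.map fun t => t.1 ^ t.2.2) = Lb.map fun t => lift t.1 ^ (p * t.2.2) := by
      simp only [L, List.map_map]; rfl
    rw [this, hD]
    exact list_prod_pow_mul Lb (fun t => lift t.1) (fun t => t.2.2) p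
  -- `D ∈ R`, `D` is an `O₁`-unit, `res D = D̄`
  have hDfacts : D ∈ R ∧ O₁.valuation D = 1 ∧ ∃ hD' : D ∈ O₁, residue O₁ ⟨D, hD'⟩ = Db := by
    rw [hD, hDb]
    clear hden hLprod hD hDb
    induction Lb with
    | nil =>
      simp only [List.map_nil, List.prod_nil, map_one]
      exact ⟨R.one_mem, trivial, O₁.one_mem, by rw [← map_one (residue O₁)]; rfl⟩
    | cons t Lb ih =>
      obtain ⟨ht0, ht1, ht2, -⟩ := hLb t (List.mem_cons_self ..)
      obtain ⟨hmem, hval, hO₁, hres⟩ := ih (fun t' ht' => hLb t' (List.mem_cons_of_mem _ ht'))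
      rw [List.map_cons, List.prod_cons, List.map_cons, List.prod_cons]
      have hf : lift t.1 ∈ R := hliftR ht1
      have hfres : residue O₁ ⟨lift t.1, hRO₁ hf⟩ = t.1 := hliftres ht1
      have hvf : O₁.valuation (lift t.1) = 1 := hunit₁ hf (by rw [hfres]; exact ht0)
      refine ⟨mul_mem (pow_mem hf _) hmem, by rw [map_mul, map_pow, hvf, one_pow, hval, one_mul],
        mul_mem (pow_mem (hRO₁ hf) _) hO₁, ?_⟩
      have e1 : (⟨lift t.1 ^ t.2.2 * (Lb.map fun t => lift t.1 ^ t.2.2).prod, mul_mem (pow_mem (hRO₁ hf) _) hO₁⟩ : O₁) =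
          ⟨lift t.1, hRO₁ hf⟩ ^ t.2.2 * ⟨_, hO₁⟩ := Subtype.ext rfl
      rw [e1, map_mul, map_pow, hfres, hres]
  obtain ⟨hDR, hvD, hDO₁, hDres⟩ := hDfacts
  have hD0 : D ≠ 0 := ne_zero_of_valuation_eq_one hvD
  -- numerators
  have haS : ∀ j, cb j * Db ∈ S := fun j => hden j
  let a : Fin p → K := fun j => lift (cb j * Db)
  have haR : ∀ j, a j ∈ R := fun j => hliftR (haS j)
  have hares : ∀ j, residue O₁ ⟨a j, hRO₁ (haR j)⟩ = cb j * Db := fun j => hliftres (haS j)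
  let c : Fin p → K := fun j => a j / D
  have hc : ∃ j : Fin p, (j : ℕ) ≠ 0 ∧ c j ≠ 0 := by
    obtain ⟨j, hj, hcj⟩ := hcb
    refine ⟨j, hj, div_ne_zero ?_ hD0⟩
    intro h0
    have : residue O₁ ⟨a j, hRO₁ (haR j)⟩ = 0 := by
      have : (⟨a j, hRO₁ (haR j)⟩ : O₁) = 0 := Subtype.ext h0
      rw [this, map_zero]
    rw [hares] at this
    rcases mul_eq_zero.mp this with h | h
    · exact hcj h
    · rw [← hDres, residue_eq_zero_iff] at h
      have := (O₁.valuation_lt_one_iff _).mp h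
      exact absurd hvD (ne_of_lt this)
  -- `G := Σ a_j^p u^j ∈ R` and its residue
  set G : K := ∑ j : Fin p, a j ^ p * u ^ (j : ℕ) with hG
  have hGR : G ∈ R := by
    refine Subring.sum_mem _ fun j _ => R.mul_mem (R.pow_mem (haR j) _) (R.pow_mem hu _)
  have hGc : (∑ j : Fin p, c j ^ p * u ^ (j : ℕ)) = G / D ^ p := by
    rw [hG, Finset.sum_div]
    refine Finset.sum_congr rfl fun j _ => ?_
    simp only [c, div_pow]
    ring
  set Gb : ResidueField O₁ := ∑ j : Fin p, cb j ^ p * residue O₁ ⟨u, hOO₁ (locAtCentre_le hAₘO hu)⟩ ^ (j : ℕ) with hGb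
  have hGres : residue O₁ ⟨G, hRO₁ hGR⟩ = Db ^ p * Gb := by
    -- the residue map on `R` is a ring hom
    let ρ : R →+* ResidueField O₁ :=
      { toFun := fun r => residue O₁ ⟨(r : K), hRO₁ r.2⟩
        map_one' := by rw [← map_one (residue O₁)]; rfl
        map_mul' := fun x y => by rw [← map_mul]; rfl
        map_zero' := by rw [← map_zero (residue O₁)]; rfl
        map_add' := fun x y => by rw [← map_add]; rfl }
    have hρG : residue O₁ ⟨G, hRO₁ hGR⟩ = ρ (∑ j : Fin p, (⟨a j, haR j⟩ : R) ^ p * (⟨u, hu⟩ : R) ^ (j : ℕ)) := by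
      change _ = residue O₁ ⟨((∑ j : Fin p, (⟨a j, haR j⟩ : R) ^ p * (⟨u, hu⟩ : R) ^ (j : ℕ) : R) : K), _⟩
      congr 1
      apply Subtype.ext
      change G = ((∑ j : Fin p, (⟨a j, haR j⟩ : R) ^ p * (⟨u, hu⟩ : R) ^ (j : ℕ) : R) : K)
      rw [hG]
      push_cast
      rfl
    rw [hρG, map_sum, hGb, Finset.mul_sum]
    refine Finset.sum_congr rfl fun j _ => ?_
    rw [map_mul, map_pow, map_pow]
    change residue O₁ ⟨a j, _⟩ ^ p * residue O₁ ⟨u, _⟩ ^ (j : ℕ) = _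
    rw [hares j, mul_pow]
    ring
  -- the upstairs list
  have hL : ∀ t ∈ L, ∃ (h₁ : t.1 ∈ locAtCentre Aₘ.toSubring O) (h₂ : t.2.1 ∈ locAtCentre Aₘ.toSubring O),
      O₁.valuation t.1 = 1 ∧
      ∃ (hs₁ : residue O₁ ⟨t.1, hOO₁ (locAtCentre_le hAₘO h₁)⟩ ∈ S)
        (hs₂ : residue O₁ ⟨t.2.1, hOO₁ (locAtCentre_le hAₘO h₂)⟩ ∈ S),
        maximalIdeal S = Ideal.span {⟨_, hs₁⟩, ⟨_, hs₂⟩} := by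
    intro t ht
    obtain ⟨tb, htb, rfl⟩ := List.mem_map.mp ht
    obtain ⟨htb0, h₁, h₂, hS⟩ := hLb tb htb
    have hf : lift tb.1 ∈ R := hliftR h₁
    have hg : lift tb.2.1 ∈ R := hliftR h₂
    have hfres : residue O₁ ⟨lift tb.1, hRO₁ hf⟩ = tb.1 := hliftres h₁
    have hgres : residue O₁ ⟨lift tb.2.1, hRO₁ hg⟩ = tb.2.1 := hliftres h₂
    refine ⟨hf, hg, hunit₁ hf (by rw [hfres]; exact htb0), by rw [hfres]; exact h₁, by rw [hgres]; exact h₂, ?_⟩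
    have e1 : (⟨tb.1, h₁⟩ : S) = ⟨residue O₁ ⟨lift tb.1, hRO₁ hf⟩, by rw [hfres]; exact h₁⟩ := Subtype.ext hfres.symm
    have e2 : (⟨tb.2.1, h₂⟩ : S) = ⟨residue O₁ ⟨lift tb.2.1, hRO₁ hg⟩, by rw [hgres]; exact h₂⟩ := Subtype.ext hgres.symm
    rw [hS, e1, e2]
  -- make `τ := π / D^p` a regular parameter
  obtain ⟨A₂, hAA₂, hA₂fg, hA₂O, hreg₂, h12, him₂, hτ₂L, hprime₂L⟩ :=
    exists_model_div_list O O₁ hOO₁ A hAfg hzd hdimA S hSdom L Aₘ hAAₘ hAₘfg hAₘO hregm himm hloc (π : K) π.2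
      (by exact hπ) hvπ hL
  have hτ₂ : (π : K) / D ^ p ∈ locAtCentre A₂.toSubring O := by rw [← hLprod]; exact hτ₂L
  have hprime₂ : Prime (⟨(π : K) / D ^ p, hτ₂⟩ : locAtCentre A₂.toSubring O) := by
    have : (⟨(π : K) / D ^ p, hτ₂⟩ : locAtCentre A₂.toSubring O) = ⟨_, hτ₂L⟩ := Subtype.ext (by
      change (π : K) / D ^ p = (π : K) / (L.map fun t => t.1 ^ t.2.2).prod
      rw [hLprod])
    rw [this]; exact hprime₂L
  set R₂ : Subring K := locAtCentre A₂.toSubring O with hR₂def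
  haveI := hreg₂
  have hR₂O : R₂ ≤ O.toSubring := locAtCentre_le hA₂O
  have hR₂O₁ : R₂ ≤ O₁.toSubring := fun z hz => hOO₁ (hR₂O hz)
  have hR₂m : ∀ r : R₂, r ∈ maximalIdeal R₂ ↔ O.valuation (r : K) < 1 := fun r => mem_maximalIdeal_locAtCentre_iff hA₂O r
  have hloc₂ : O₁.toSubring ≤ locAtCentre R₂ O₁ := hloc.trans (locAtCentre_mono O₁ h12)
  have hvτ : O₁.valuation ((π : K) / D ^ p) < 1 := by rw [map_div₀, map_pow, hvD, one_pow, div_one]; exact hvπ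
  have hker₂ : ∀ r : R₂, residue O₁ ⟨(r : K), hR₂O₁ r.2⟩ = 0 ↔ (⟨(π : K) / D ^ p, hτ₂⟩ : R₂) ∣ r :=
    residue_eq_zero_iff_dvd O₁ R₂ hR₂O₁ hloc₂ _ hprime₂ hvτ
  have hdimR₂ : ringKrullDim R₂ = 3 := by
    rw [hR₂def, ringKrullDim_locAtCentre_eq_of_isMaximal A₂ hA₂fg O hA₂O (hzd _ hA₂O (fun z hz => hAA₂ hz)),
      ringKrullDim_eq_of_fg_of_le hAfg hA₂fg hAA₂, hdimA]
  -- the residue map `R₂ ↠ S`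
  have hresmem₂ : ∀ (z : K) (hz : z ∈ R₂), residue O₁ ⟨z, hR₂O₁ hz⟩ ∈ S := fun z hz => him₂ ▸ residue_mem_residueImage O₁ R₂ hR₂O₁ hz
  let f : R₂ →+* S :=
    { toFun := fun r => ⟨residue O₁ ⟨(r : K), hR₂O₁ r.2⟩, hresmem₂ _ r.2⟩
      map_one' := Subtype.ext (by change residue O₁ ⟨((1 : R₂) : K), _⟩ = 1; rw [← map_one (residue O₁)]; rfl)
      map_mul' := fun x y => Subtype.ext (by
        change residue O₁ ⟨((x * y : R₂) : K), _⟩ = residue O₁ _ * residue O₁ _; rw [← map_mul]; rfl)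
      map_zero' := Subtype.ext (by change residue O₁ ⟨((0 : R₂) : K), _⟩ = 0; rw [← map_zero (residue O₁)]; rfl)
      map_add' := fun x y => Subtype.ext (by
        change residue O₁ ⟨((x + y : R₂) : K), _⟩ = residue O₁ _ + residue O₁ _; rw [← map_add]; rfl) }
  have hf : Function.Surjective f := by
    rintro ⟨s, hs⟩
    obtain ⟨z, hz, hzs⟩ := (mem_residueImage_iff O₁ R₂ hR₂O₁ s).mp (him₂.symm ▸ hs)
    exact ⟨⟨z, hz⟩, Subtype.ext hzs⟩
  have hfval : ∀ r : R₂, ((f r : S) : ResidueField O₁) = residue O₁ ⟨(r : K), hR₂O₁ r.2⟩ := fun r => rfl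
  -- the decomposition `G = D^p · (lift of the clean form) + π W`, i.e. `Σ c_j^p u^j = lift + τ W`
  have hdecomp : ∀ (E : K) (hE : E ∈ R), residue O₁ ⟨E, hRO₁ hE⟩ = Gb →
      ∃ W : K, W ∈ R ∧ (∑ j : Fin p, c j ^ p * u ^ (j : ℕ)) = E + (π : K) / D ^ p * W := by
    intro E hE hEres
    have hzero : residue O₁ ⟨((⟨G, hGR⟩ - ⟨D, hDR⟩ ^ p * ⟨E, hE⟩ : R) : K), hRO₁ (⟨G, hGR⟩ - ⟨D, hDR⟩ ^ p * ⟨E, hE⟩ : R).2⟩ = 0 := by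
      have : residue O₁ ⟨((⟨G, hGR⟩ - ⟨D, hDR⟩ ^ p * ⟨E, hE⟩ : R) : K), hRO₁ (⟨G, hGR⟩ - ⟨D, hDR⟩ ^ p * ⟨E, hE⟩ : R).2⟩ =
          residue O₁ ⟨G, hRO₁ hGR⟩ - residue O₁ ⟨D, hDO₁⟩ ^ p * residue O₁ ⟨E, hRO₁ hE⟩ := by
        rw [← map_pow, ← map_mul, ← map_sub]; rfl
      rw [this, hGres, hDres, hEres, sub_self]
    obtain ⟨W, hW⟩ := (hker _).mp hzero
    refine ⟨(W : K), W.2, ?_⟩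
    have hW' : G - D ^ p * E = (π : K) * (W : K) := by
      have := congrArg (fun r : R => (r : K)) hW
      simpa using this
    have hGeq : G = D ^ p * E + (π : K) * W := by rw [← hW']; ring
    rw [hGc, hGeq]
    field_simp
  -- CASES on the downstairs form
  rcases hclean with ⟨aa, bb, ε, hε, hab, ha, hb, hform⟩ | ⟨w, hw, hform, hwres⟩ | ⟨s, c', hform, h1, h2⟩
  · -- form (1): lift `ε, x̄, ȳ`
    have hεR : lift (ε : ResidueField O₁) ∈ R := hliftR ε.2
    have hεres : residue O₁ ⟨lift (ε : ResidueField O₁), hRO₁ hεR⟩ = ε := hliftres ε.2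
    have hXR : lift (xb : ResidueField O₁) ∈ R := hliftR xb.2
    have hXres : residue O₁ ⟨lift (xb : ResidueField O₁), hRO₁ hXR⟩ = xb := hliftres xb.2
    have hYR : lift (yb : ResidueField O₁) ∈ R := hliftR yb.2
    have hYres : residue O₁ ⟨lift (yb : ResidueField O₁), hRO₁ hYR⟩ = yb := hliftres yb.2
    set E₁ : K := lift (ε : ResidueField O₁) with hE₁
    set X : K := lift (xb : ResidueField O₁) with hX
    set Y : K := lift (yb : ResidueField O₁) with hY
    have hEXY : E₁ * X ^ aa * Y ^ bb ∈ R := R.mul_mem (R.mul_mem hεR (R.pow_mem hXR _)) (R.pow_mem hYR _)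
    have hEXYres : residue O₁ ⟨E₁ * X ^ aa * Y ^ bb, hRO₁ hEXY⟩ = Gb := by
      have : residue O₁ ⟨E₁ * X ^ aa * Y ^ bb, hRO₁ hEXY⟩ =
          residue O₁ ⟨E₁, hRO₁ hεR⟩ * residue O₁ ⟨X, hRO₁ hXR⟩ ^ aa * residue O₁ ⟨Y, hRO₁ hYR⟩ ^ bb := by
        rw [← map_pow, ← map_pow, ← map_mul, ← map_mul]; rfl
      rw [this, hεres, hXres, hYres, ← hform]
    obtain ⟨W, hWR, hg⟩ := hdecomp _ hEXY hEXYres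
    have hvE : O.valuation E₁ = 1 := by
      have hu' : IsUnit (⟨E₁, hεR⟩ : R) := hunitR hεR (by
        have : (⟨residue O₁ ⟨E₁, hRO₁ hεR⟩, hresmem E₁ hεR⟩ : S) = ε := Subtype.ext hεres
        rw [this]; exact hε)
      by_contra hne
      have hlt : O.valuation E₁ < 1 := lt_of_le_of_ne ((O.valuation_le_one_iff _).mpr (hRO hεR)) hne
      exact (IsLocalRing.mem_maximalIdeal _).mp ((hRm ⟨E₁, hεR⟩).mpr hlt) hu'
    have hvX : O₁.valuation X = 1 := hunit₁ hXR (by rw [hXres]; exact hxb0)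
    have hvY : O₁.valuation Y = 1 := hunit₁ hYR (by rw [hYres]; exact hyb0)
    -- `𝔪(R₂) = (τ, X, Y)`
    have hXS : residue O₁ ⟨X, hOO₁ (hR₂O (h12 hXR))⟩ ∈ S := by rw [hXres]; exact xb.2
    have hYS : residue O₁ ⟨Y, hOO₁ (hR₂O (h12 hYR))⟩ ∈ S := by rw [hYres]; exact yb.2
    have hxy' : maximalIdeal S = Ideal.span {⟨_, hXS⟩, ⟨_, hYS⟩} := by
      have e1 : xb = ⟨_, hXS⟩ := Subtype.ext hXres.symm
      have e2 : yb = ⟨_, hYS⟩ := Subtype.ext hYres.symm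
      rw [hxy, e1, e2]
    have hmax₂ : maximalIdeal R₂ = Ideal.span {(⟨(π : K) / D ^ p, hτ₂⟩ : R₂), ⟨X, h12 hXR⟩, ⟨Y, h12 hYR⟩} :=
      maximalIdeal_eq_span_of_residue O O₁ hOO₁ R₂ hR₂O hR₂m ⟨_, hτ₂⟩ hvτ (fun r hr => (hker₂ r).mp hr) S hSdom him₂
        ⟨X, h12 hXR⟩ ⟨Y, h12 hYR⟩ hXS hYS hxy'
    have hdeep : ∀ a' b' : ℕ, O.valuation ((π : K) / D ^ p) < O.valuation (X ^ a' * Y ^ b') := fun a' b' =>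
      valuation_lt_of_le_of_valuation_lt O O₁ hOO₁ (by rw [map_mul, map_pow, map_pow, hvX, hvY, one_pow, one_pow, one_mul]; exact hvτ)
    have hg' : (∑ j : Fin p, c j ^ p * u ^ (j : ℕ)) = E₁ * (X ^ aa * Y ^ bb) + (π : K) / D ^ p * W := by rw [hg]; ring
    obtain ⟨A₃, hAA₃, hA₃fg, hA₃O, hreg₃, -, hdim₃, k₁, k₂, k₃, w'', hmax₃, hw'', hgw⟩ :=
      formOne_lift O A hAfg hzd hdimA A₂ hAA₂ hA₂fg hA₂O hreg₂ _ X Y hτ₂ (h12 hXR) (h12 hYR) hmax₂ hdeep aa bb _ E₁ W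
        (h12 hεR) hvE (h12 hWR) hg'
    haveI := hreg₃
    refine ⟨A₃, hA₃O, hAA₃, hA₃fg, hreg₃, c, hc, forms_of_looseCleanForm ?_⟩
    exact looseCleanForm_of_unit_mul_monomial p _ hdim₃ _ _ _ hmax₃ w'' hw'' aa bb hab ha hb _ (by rw [hgw]; ring)
  · -- form (2)
    have hwR : lift (w : ResidueField O₁) ∈ R := hliftR w.2
    have hwres' : residue O₁ ⟨lift (w : ResidueField O₁), hRO₁ hwR⟩ = w := hliftres w.2
    obtain ⟨W, hWR, hg⟩ := hdecomp _ hwR (by rw [hwres', ← hform])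
    have hgR₂ : (∑ j : Fin p, c j ^ p * u ^ (j : ℕ)) ∈ R₂ := by
      rw [hg]; exact R₂.add_mem (h12 hwR) (R₂.mul_mem hτ₂ (h12 hWR))
    have hfg : f ⟨_, hgR₂⟩ = w := by
      apply Subtype.ext
      rw [hfval]
      have : (⟨(∑ j : Fin p, c j ^ p * u ^ (j : ℕ)), hR₂O₁ hgR₂⟩ : O₁) =
          ⟨lift (w : ResidueField O₁), hRO₁ hwR⟩ + ⟨(π : K) / D ^ p, hR₂O₁ hτ₂⟩ * ⟨W, hRO₁ hWR⟩ := Subtype.ext hg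
      rw [this, map_add, map_mul, hwres']
      have hτ0 : residue O₁ ⟨(π : K) / D ^ p, hR₂O₁ hτ₂⟩ = 0 := by
        rw [residue_eq_zero_iff]; exact (O₁.valuation_lt_one_iff _).mpr hvτ
      rw [hτ0, zero_mul, add_zero]
    obtain ⟨hunit, hres⟩ := formTwo_lift f hf p ⟨_, hgR₂⟩ (by rw [hfg]; exact hw) (by rw [hfg]; exact hwres)
    exact ⟨A₂, hA₂O, hAA₂, hA₂fg, hreg₂, c, hc, Or.inr (Or.inl ⟨⟨_, hgR₂⟩, hunit, rfl, hres⟩)⟩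
  · -- form (3)
    have hsR : lift (s : ResidueField O₁) ∈ R := hliftR s.2
    have hsres : residue O₁ ⟨lift (s : ResidueField O₁), hRO₁ hsR⟩ = s := hliftres s.2
    have hcR : lift (c' : ResidueField O₁) ∈ R := hliftR c'.2
    have hcres : residue O₁ ⟨lift (c' : ResidueField O₁), hRO₁ hcR⟩ = c' := hliftres c'.2
    obtain ⟨W, hWR, hg⟩ := hdecomp _ hsR (by rw [hsres, ← hform])
    have hgR₂ : (∑ j : Fin p, c j ^ p * u ^ (j : ℕ)) ∈ R₂ := by
      rw [hg]; exact R₂.add_mem (h12 hsR) (R₂.mul_mem hτ₂ (h12 hWR))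
    have hfg : f ⟨_, hgR₂⟩ = s := by
      apply Subtype.ext
      rw [hfval]
      have : (⟨(∑ j : Fin p, c j ^ p * u ^ (j : ℕ)), hR₂O₁ hgR₂⟩ : O₁) =
          ⟨lift (s : ResidueField O₁), hRO₁ hsR⟩ + ⟨(π : K) / D ^ p, hR₂O₁ hτ₂⟩ * ⟨W, hRO₁ hWR⟩ := Subtype.ext hg
      rw [this, map_add, map_mul, hsres]
      have hτ0 : residue O₁ ⟨(π : K) / D ^ p, hR₂O₁ hτ₂⟩ = 0 := by
        rw [residue_eq_zero_iff]; exact (O₁.valuation_lt_one_iff _).mpr hvτ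
      rw [hτ0, zero_mul, add_zero]
    have hfc : f ⟨lift (c' : ResidueField O₁), h12 hcR⟩ = c' := Subtype.ext (by rw [hfval]; exact hcres)
    obtain ⟨hm1, hm2⟩ := formThree_lift f hf p ⟨_, hgR₂⟩ ⟨_, h12 hcR⟩ (by rw [hfg, hfc]; exact h1) (by rw [hfg, hfc]; exact h2)
    exact ⟨A₂, hA₂O, hAA₂, hA₂fg, hreg₂, c, hc, Or.inr (Or.inr ⟨⟨_, hgR₂⟩, ⟨_, h12 hcR⟩, rfl, hm1, hm2⟩)⟩

end Summit.ResolutionOfSingularities.ResolutionOfSingularities.Theorems.RadicialJung.CleanModels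

end
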